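import Summits.Ventures.PercRepro.GenQNearEndPiecesGenD
import Summits.Ventures.PercRepro.Night4TrT6C17Q6M0Z

/-!
# PercRepro — the trace-layer, corank-`17` near-end case of `TraceSixResidue` (type `6`, `m = 0`) from its pieces (night-4, gen 10)

`traceSum_t6_c17_near_end`: the branch certificate `traceSum_nonneg_t6_c17_q6_m0` (no rank-`5` flat trace of `≥ 20` of the `23` points, kernel),
the trace functional on the rank-`5` sets of `21` points (the shape «rank-`5` trace + 2 points», `traceHypAddTwoProfile ≥ 0`)
and the SHARP functional `traceHypAddProfileS ≥ 0` on the traces `H ∩ G` of the rank-`5` flats with complements of 3 … 3 points give the level-`7` trace sum at type `6` on every coloop-free rank-`6` set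
of `23` points (`traceSum_succ_of_branch_and_functionalsS` at `q = 5`, depth `3`).
-/
namespace PercRepro.GenQ

open Finset ThmH SixFour PerFlat Star

variable {α : Type*} [DecidableEq α] {M : Matroid α} [M.Finite]

/-- **The trace-layer corank-`17` case from the branch certificate and the named pieces.** -/
theorem traceSum_t6_c17_near_end (hs : Simple M) (hline : ∀ L ∈ flatsQ M 2, L.card ≤ 3)
    (hplane : ∀ P ∈ flatsQ M 3, P.card ≤ 6) (hsolid : ∀ F ∈ flatsQ M 4, F.card ≤ 10)
    (hflat5 : ∀ F ∈ flatsQ M 5, F.card ≤ 21) (hflat6 : ∀ F ∈ flatsQ M 6, F.card ≤ 43)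
    (htwo : ∀ (τ : Finset α) (a a' : α), τ ⊆ gr M → M.eRk (τ : Set α) = ((5 : ℕ) : ℕ∞) → τ.card + 2 = 23 →
      a ∈ gr M → a' ∈ gr M → a ≠ a' → a ∉ τ → a' ∉ τ → a ∉ M.closure (τ : Set α) → a' ∉ M.closure (τ : Set α) →
      M.eRk ((insert a (insert a' τ) : Finset α) : Set α) = ((5 : ℕ) : ℕ∞) + 1 → 0 ≤ traceHypAddTwoProfile M τ a a' 5 6)
    (hshapeP : ∀ (G H : Finset α), G ⊆ gr M → M.eRk (G : Set α) = ((6 : ℕ) : ℕ∞) → G.card = 23 → mTr M G = 0 →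
      H ∈ flatsQ M 5 → 3 ≤ (G \ H).card → (G \ H).card ≤ 3 → 0 ≤ traceHypAddProfileS M (H ∩ G) (G \ H) 5 6)
    {G : Finset α} (hG : G ⊆ gr M) (hrG : M.eRk (G : Set α) = ((6 : ℕ) : ℕ∞)) (hcard : G.card = 6 + 17)
    (hmG : mTr M G = 0) : 0 ≤ ∑ B ∈ Rq M G 6, ((((6 + 1 : ℕ) : ℚ) + 2 - ((6 : ℕ) : ℚ)) * (1 / (2 + (mTr M B : ℚ))) - ((((6 + 1 : ℕ) : ℚ) + 2) / (((6 + 1 : ℕ) : ℚ) + 1)) * dem M G 6 B) :=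
  traceSum_succ_of_branch_and_functionalsS (q := 5) (n := 23) (t := 6) (t₀ := 3) (by norm_num) (by norm_num)
    (fun G' hG' hrG' hcard' hmG' hbig =>
      Night4.traceSum_nonneg_t6_c17_q6_m0 hs hline hplane hsolid hflat5 hflat6 hG' hrG' hcard' hmG' hbig)
    htwo hshapeP G hG hrG hcard hmG

end PercRepro.GenQ
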